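import Literature.Computability.Complexity.AOWTraceWalks
import Summits.PneNP.PneNP.Theorems.SfmBlMachineTraceFn

/-!
# Line «sfm-bl», MACHINE LAYER M3b (part 2): closed leg-walks ↔ admissible pairs; the trace sum as a pair sum (stmt-PneNP-20523)

FRONTIER F-N1c; nothing here bears on P vs NP.

The COMBINATORIAL CORE of the identification of the machine's `traceSum` (M3a, `SfmBlMachineTrace`) with the
right-hand side of p3's `SfmBl.sum_cylinder_trace_pow_eq_parts`: a pair of functions `L, L' : Fin (q+1) → legs`
is laid out as the forward sequence `L 0, L' 0, L 1, L' 1, …` (`pairFn`, `seqOf`); forward admissibility plus the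
machine's closure test is EXACTLY `IsAdmissible labL labR L L'` (the Allen–O'Donnell–Witmer admissibility of
`Literature.Computability.Complexity.AOWTraceWalks`, cyclic in `Fin (q+1)`) — `fwdAdm_pairFn_iff`,
`mem_filter_isClosed_aseqsU_iff`; the closed enumerated sequences are a PERMUTATION of the sequences of the
admissible pairs of remainder legs (`perm_filter_isClosed_aseqsU`), hence
**`sum_map_filter_isClosed_aseqsU` / `traceSum_eq_sum_pairs`**: the machine's list sum equals
`Σ_{L, L' : Fin (q+1) → Fin |rl|} [IsAdmissible] f (seqOf …)` (pairs indexed by positions in the remainder-leg list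
`rl`; the consumer transports along its bijection `remainder legs ≃ Fin |rl|`).  Finally `count_outs_seqOf`: the
multiplicity of output `i` in the sequence is `μ i = #{j : (L j).1 = i} + #{j : (L' j).1 = i}` — the exponent data
of the cylinder formula (so `freeEven` / `sgnPar` / `contrib` read off `μ`).  Definition-light (`pairFn`, `seqOf`,
`admPairs`, `seqOf'`).
-/

set_option linter.dupNamespace false -- `Summit.PneNP.PneNP.…`: summit = sub-problem name (D-0017 single-conjunct layout)

namespace Summit.PneNP.PneNP.Theorems.SfmBlMachine

open Literature.Computability.Complexity (IsAdmissible)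

/-! ## Closed sequences of `2(q+1)` legs ↔ admissible pairs `(L, L')` -/

section Pairs

variable {q : ℕ}

/-- The forward function of a pair `(L, L')`: `L j` at position `2j`, `L' j` at position `2j + 1`. -/
def pairFn (L L' : Fin (q + 1) → PLeg) : Fin (2 * q + 1 + 1) → PLeg :=
  fun p => if p.val % 2 = 0 then L ⟨p.val / 2, by omega⟩ else L' ⟨p.val / 2, by omega⟩

/-- The machine's sequence (most recent first) of a pair `(L, L')`. -/
def seqOf (L L' : Fin (q + 1) → PLeg) : List PLeg := (List.ofFn (pairFn L L')).reverse

/-- Even positions carry `L`. -/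
theorem pairFn_even (L L' : Fin (q + 1) → PLeg) (j : Fin (q + 1)) :
    pairFn L L' ⟨2 * j.val, by omega⟩ = L j := by
  dsimp only [pairFn]
  rw [if_pos (show 2 * j.val % 2 = 0 by omega)]
  exact congrArg L (Fin.ext (show 2 * j.val / 2 = j.val by omega))

/-- Odd positions carry `L'`. -/
theorem pairFn_odd (L L' : Fin (q + 1) → PLeg) (j : Fin (q + 1)) :
    pairFn L L' ⟨2 * j.val + 1, by omega⟩ = L' j := by
  dsimp only [pairFn]
  rw [if_neg (show ¬ ((2 * j.val + 1) % 2 = 0) by omega)]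
  exact congrArg L' (Fin.ext (show (2 * j.val + 1) / 2 = j.val by omega))

/-- `(L, L') ↦ pairFn L L'` is injective. -/
theorem pairFn_injective₂ {L₁ L₁' L₂ L₂' : Fin (q + 1) → PLeg} (h : pairFn L₁ L₁' = pairFn L₂ L₂') :
    L₁ = L₂ ∧ L₁' = L₂' := by
  constructor
  · funext j; rw [← pairFn_even L₁ L₁' j, ← pairFn_even L₂ L₂' j, h]
  · funext j; rw [← pairFn_odd L₁ L₁' j, ← pairFn_odd L₂ L₂' j, h]

/-- `seqOf` is injective in the pair. -/
theorem seqOf_injective₂ {L₁ L₁' L₂ L₂' : Fin (q + 1) → PLeg} (h : seqOf L₁ L₁' = seqOf L₂ L₂') :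
    L₁ = L₂ ∧ L₁' = L₂' := by
  unfold seqOf at h
  exact pairFn_injective₂ (List.ofFn_injective (List.reverse_injective h))

/-- Every forward function of even length comes from a pair. -/
theorem exists_pairFn_eq (g : Fin (2 * q + 1 + 1) → PLeg) :
    ∃ L L' : Fin (q + 1) → PLeg, pairFn L L' = g := by
  refine ⟨fun j => g ⟨2 * j.val, by omega⟩, fun j => g ⟨2 * j.val + 1, by omega⟩, funext fun p => ?_⟩
  dsimp only [pairFn]
  split_ifs with h
  · exact congrArg g (Fin.ext (show 2 * (p.val / 2) = p.val by omega))
  · exact congrArg g (Fin.ext (show 2 * (p.val / 2) + 1 = p.val by omega))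

/-- **Forward admissibility + closure of the pair function = admissibility of the pair** (values in `rl`). -/
theorem fwdAdm_pairFn_iff (rl : List PLeg) (L L' : Fin (q + 1) → PLeg) :
    (FwdAdm rl (2 * q + 1) (pairFn L L') ∧ labR (L' (Fin.last q)) = labR (L 0))
      ↔ ((∀ j, L j ∈ rl ∧ L' j ∈ rl) ∧ IsAdmissible labL labR L L') := by
  constructor
  · rintro ⟨⟨hmem, hlink⟩, hcl⟩
    refine ⟨fun j => ⟨by rw [← pairFn_even L L' j]; exact hmem _, by rw [← pairFn_odd L L' j]; exact hmem _⟩,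
      fun j => ⟨?_, ?_⟩⟩
    · have h := hlink (2 * j.val) (by omega)
      unfold Link at h
      rw [if_pos (by omega)] at h
      rwa [show (⟨2 * j.val, _⟩ : Fin (2 * q + 1 + 1)) = ⟨2 * j.val, by omega⟩ from rfl, pairFn_even,
        show (⟨2 * j.val + 1, _⟩ : Fin (2 * q + 1 + 1)) = ⟨2 * j.val + 1, by omega⟩ from rfl, pairFn_odd] at h
    · by_cases hj : j.val < q
      · have h := hlink (2 * j.val + 1) (by omega)
        unfold Link at h
        rw [if_neg (by omega)] at h
        have hj1 : (j + 1 : Fin (q + 1)) = ⟨j.val + 1, by omega⟩ := by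
          ext; rw [Fin.val_add_one_of_lt (by simpa [Fin.lt_def] using hj)]
        rw [hj1, ← pairFn_even L L' ⟨j.val + 1, by omega⟩, ← pairFn_odd L L' j]
        rw [show (⟨2 * (j.val + 1), _⟩ : Fin (2 * q + 1 + 1)) = ⟨2 * j.val + 1 + 1, by omega⟩ from
          Fin.ext (by simp; ring)]
        exact h.symm
      · have hjq : j = Fin.last q := Fin.ext (by simp; omega)
        subst hjq
        rw [Fin.last_add_one]; exact hcl
  · rintro ⟨hmem, hadm⟩
    refine ⟨⟨fun p => ?_, fun p hp => ?_⟩, ?_⟩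
    · unfold pairFn; split_ifs
      · exact (hmem _).1
      · exact (hmem _).2
    · unfold Link
      by_cases hpar : p % 2 = 0
      · rw [if_pos hpar]
        obtain ⟨j, hj, rfl⟩ : ∃ j, j < q + 1 ∧ p = 2 * j := ⟨p / 2, by omega, by omega⟩
        have h := (hadm ⟨j, hj⟩).1
        rw [show (⟨2 * j, _⟩ : Fin (2 * q + 1 + 1)) = ⟨2 * (⟨j, hj⟩ : Fin (q + 1)).val, by simp; omega⟩ from rfl,
          pairFn_even, show (⟨2 * j + 1, hp⟩ : Fin (2 * q + 1 + 1)) = ⟨2 * (⟨j, hj⟩ : Fin (q + 1)).val + 1, by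
            simp; omega⟩ from rfl, pairFn_odd]
        exact h
      · rw [if_neg hpar]
        obtain ⟨j, hj, rfl⟩ : ∃ j, j < q ∧ p = 2 * j + 1 := ⟨p / 2, by omega, by omega⟩
        have h := (hadm ⟨j, by omega⟩).2
        have hj1 : ((⟨j, by omega⟩ : Fin (q + 1)) + 1) = ⟨j + 1, by omega⟩ := by
          ext; rw [Fin.val_add_one_of_lt (by simp [Fin.lt_def]; omega)]
        rw [hj1] at h
        rw [show (⟨2 * j + 1, _⟩ : Fin (2 * q + 1 + 1)) = ⟨2 * (⟨j, by omega⟩ : Fin (q + 1)).val + 1, by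
            simp; omega⟩ from rfl, pairFn_odd,
          show (⟨2 * j + 1 + 1, hp⟩ : Fin (2 * q + 1 + 1)) = ⟨2 * (⟨j + 1, by omega⟩ : Fin (q + 1)).val, by
            simp; omega⟩ from Fin.ext (by simp; omega), pairFn_even]
        exact h.symm
    · have h := (hadm (Fin.last q)).2
      rwa [Fin.last_add_one] at h

/-- The machine's closure test on the sequence of a pair. -/
theorem isClosed_seqOf (L L' : Fin (q + 1) → PLeg) :
    isClosed (seqOf L L') = decide (labR (L' (Fin.last q)) = labR (L 0)) := by
  unfold isClosed seqOf
  rw [List.reverse_reverse, getD_reverse_ofFn_zero]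
  have h0 : (List.ofFn (pairFn L L')).getD 0 dleg = L 0 := by
    rw [List.getD_eq_getElem _ _ (by simp), List.getElem_ofFn]
    exact pairFn_even L L' 0
  have hl : pairFn L L' (Fin.last (2 * q + 1)) = L' (Fin.last q) := by
    rw [← pairFn_odd L L' (Fin.last q)]
    congr 1
  rw [h0, hl]

/-- **THE CLOSED ENUMERATED SEQUENCES ARE EXACTLY THE SEQUENCES OF THE ADMISSIBLE PAIRS OF REMAINDER LEGS.** -/
theorem mem_filter_isClosed_aseqsU_iff (rl : List PLeg) (s : List PLeg) :
    s ∈ (aseqsU rl (2 * q + 1)).filter isClosed ↔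
      ∃ L L' : Fin (q + 1) → PLeg, (∀ j, L j ∈ rl ∧ L' j ∈ rl) ∧ IsAdmissible labL labR L L' ∧ s = seqOf L L' := by
  rw [List.mem_filter, mem_aseqsU_iff_ofFn]
  constructor
  · rintro ⟨⟨g, hg, rfl⟩, hcl⟩
    obtain ⟨L, L', rfl⟩ := exists_pairFn_eq g
    have hcl' : labR (L' (Fin.last q)) = labR (L 0) := by
      have := isClosed_seqOf L L'
      unfold seqOf at this
      rw [this, decide_eq_true_eq] at hcl
      exact hcl
    obtain ⟨hmem, hadm⟩ := (fwdAdm_pairFn_iff rl L L').1 ⟨hg, hcl'⟩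
    exact ⟨L, L', hmem, hadm, rfl⟩
  · rintro ⟨L, L', hmem, hadm, rfl⟩
    obtain ⟨hfwd, hcl⟩ := (fwdAdm_pairFn_iff rl L L').2 ⟨hmem, hadm⟩
    exact ⟨⟨pairFn L L', hfwd, rfl⟩, by rw [isClosed_seqOf, decide_eq_true_eq]; exact hcl⟩

end Pairs

/-! ## The machine's list sum as a `Finset` sum over admissible pairs -/

section Sum

variable {q : ℕ}

/-- The admissible pairs of remainder legs, as pairs of INDEX functions into `rl`. -/
def admPairs (rl : List PLeg) (q : ℕ) :
    Finset ((Fin (q + 1) → Fin rl.length) × (Fin (q + 1) → Fin rl.length)) :=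
  Finset.univ.filter fun LL => IsAdmissible (fun a => labL (rl.get a)) (fun a => labR (rl.get a)) LL.1 LL.2

/-- The sequence of a pair of index functions. -/
def seqOf' (rl : List PLeg) (LL : (Fin (q + 1) → Fin rl.length) × (Fin (q + 1) → Fin rl.length)) : List PLeg :=
  seqOf (fun j => rl.get (LL.1 j)) (fun j => rl.get (LL.2 j))

/-- `seqOf'` is injective (for `rl` without duplicates). -/
theorem seqOf'_injective {rl : List PLeg} (hrl : rl.Nodup) : Function.Injective (seqOf' (q := q) rl) := by
  have hget : Function.Injective rl.get := List.nodup_iff_injective_get.1 hrl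
  rintro ⟨L₁, L₁'⟩ ⟨L₂, L₂'⟩ h
  obtain ⟨h1, h2⟩ := seqOf_injective₂ h
  exact Prod.ext (funext fun j => hget (congrFun h1 j)) (funext fun j => hget (congrFun h2 j))

/-- The closed enumerated sequences, as a list, are a permutation of the sequences of the admissible pairs. -/
theorem perm_filter_isClosed_aseqsU {rl : List PLeg} (hrl : rl.Nodup) (q : ℕ) :
    List.Perm ((aseqsU rl (2 * q + 1)).filter isClosed) ((admPairs rl q).toList.map (seqOf' rl)) := by
  rw [List.perm_ext_iff_of_nodup ((nodup_aseqsU hrl _).filter _)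
    ((Finset.nodup_toList _).map (seqOf'_injective hrl))]
  intro s
  rw [mem_filter_isClosed_aseqsU_iff, List.mem_map]
  constructor
  · rintro ⟨L, L', hmem, hadm, rfl⟩
    have hι : ∀ j, ∃ a : Fin rl.length, rl.get a = L j := fun j => List.mem_iff_get.1 (hmem j).1
    have hι' : ∀ j, ∃ a : Fin rl.length, rl.get a = L' j := fun j => List.mem_iff_get.1 (hmem j).2
    choose ι hι using hι
    choose ι' hι' using hι'
    have e1 : (fun j => rl.get (ι j)) = L := funext hι
    have e2 : (fun j => rl.get (ι' j)) = L' := funext hι'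
    refine ⟨(ι, ι'), ?_, by unfold seqOf'; rw [e1, e2]⟩
    rw [Finset.mem_toList]
    unfold admPairs
    rw [Finset.mem_filter]
    refine ⟨Finset.mem_univ _, fun j => ?_⟩
    have := hadm j
    simp only [hι, hι']
    exact this
  · rintro ⟨LL, hLL, rfl⟩
    rw [Finset.mem_toList] at hLL
    unfold admPairs at hLL
    rw [Finset.mem_filter] at hLL
    exact ⟨fun j => rl.get (LL.1 j), fun j => rl.get (LL.2 j), fun j => ⟨List.get_mem _ _, List.get_mem _ _⟩, hLL.2, rfl⟩

/-- **M3b, COMBINATORIAL CORE**: the machine's sum over the closed enumerated sequences of `2(q+1)` remainder legs IS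
the sum over the admissible pairs `(L, L')` of remainder legs, indexed by positions in `rl` (the indexing of
`SfmBl.sum_cylinder_trace_pow_eq_parts` up to the consumer's bijection between its remainder-leg type and `Fin |rl|`). -/
theorem sum_map_filter_isClosed_aseqsU {rl : List PLeg} (hrl : rl.Nodup) (q : ℕ) (f : List PLeg → ℤ) :
    (((aseqsU rl (2 * q + 1)).filter isClosed).map f).sum
      = ∑ L : Fin (q + 1) → Fin rl.length, ∑ L' : Fin (q + 1) → Fin rl.length,
          if IsAdmissible (fun a => labL (rl.get a)) (fun a => labR (rl.get a)) L L'
          then f (seqOf (fun j => rl.get (L j)) (fun j => rl.get (L' j))) else 0 := by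
  rw [((perm_filter_isClosed_aseqsU hrl q).map f).sum_eq, List.map_map, Finset.sum_map_toList,
    ← Fintype.sum_prod_type', admPairs, Finset.sum_filter]
  rfl

/-- The same for the machine's `traceSum`, when the cap is not binding. -/
theorem traceSum_eq_sum_pairs {rl : List PLeg} (hrl : rl.Nodup) (q cap : ℕ) (u : List Unit) (hu : u.length = 2 * q + 1)
    (hcap : ∀ k, k ≤ u.length → (aseqsU rl k).length ≤ cap) (k : ℕ) (T0 : List Bool) (pw : ℤ) :
    traceSum k T0 pw rl cap u
      = ∑ L : Fin (q + 1) → Fin rl.length, ∑ L' : Fin (q + 1) → Fin rl.length,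
          if IsAdmissible (fun a => labL (rl.get a)) (fun a => labR (rl.get a)) L L'
          then contrib k T0 pw (seqOf (fun j => rl.get (L j)) (fun j => rl.get (L' j))) else 0 := by
  unfold traceSum
  rw [aseqsC_eq_aseqsU rl cap u hcap, hu]
  exact sum_map_filter_isClosed_aseqsU hrl q _

/-- Counting the positions of `List.ofFn g` (read through `Prod.fst`) with a given value. -/
theorem count_map_fst_ofFn {n : ℕ} (g : Fin n → PLeg) (i : ℕ) :
    ((List.ofFn g).reverse.map fun x => x.1).count i = (Finset.univ.filter fun p => (g p).1 = i).card := by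
  classical
  rw [List.map_reverse, List.count_reverse, List.count_eq_countP, List.countP_map, List.ofFn_eq_map, List.countP_map,
    List.countP_eq_length_filter, ← List.toFinset_card_of_nodup ((List.nodup_finRange _).filter _),
    List.toFinset_filter, List.toFinset_finRange]
  congr 1
  ext p
  simp [Function.comp]

/-- The outputs of the sequence of a pair: every output of `L` and of `L'`, with multiplicity —
`(outs (seqOf L L')).count i = #{j : (L j).1 = i} + #{j : (L' j).1 = i}` (the `μ i` of
`SfmBl.sum_cylinder_trace_pow_eq_parts`). -/
theorem count_outs_seqOf (L L' : Fin (q + 1) → PLeg) (i : ℕ) :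
    (outs (seqOf L L')).count i
      = (Finset.univ.filter fun j => (L j).1 = i).card + (Finset.univ.filter fun j => (L' j).1 = i).card := by
  classical
  unfold outs seqOf
  rw [count_map_fst_ofFn]
  -- split the positions `Fin (2q+2)` into even and odd ones
  let ev : Fin (q + 1) ↪ Fin (2 * q + 1 + 1) :=
    ⟨fun j => ⟨2 * j.val, by omega⟩, fun a b h => Fin.ext (by
      have h' : (2 * a.val : ℕ) = 2 * b.val := congrArg Fin.val h
      omega)⟩
  let od : Fin (q + 1) ↪ Fin (2 * q + 1 + 1) :=
    ⟨fun j => ⟨2 * j.val + 1, by omega⟩, fun a b h => Fin.ext (by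
      have h' : (2 * a.val + 1 : ℕ) = 2 * b.val + 1 := congrArg Fin.val h
      omega)⟩
  have hev : ∀ j, ev j = ⟨2 * j.val, by omega⟩ := fun j => rfl
  have hod : ∀ j, od j = ⟨2 * j.val + 1, by omega⟩ := fun j => rfl
  have hsplit : (Finset.univ.filter fun p : Fin (2 * q + 1 + 1) => (pairFn L L' p).1 = i)
      = ((Finset.univ.filter fun j : Fin (q + 1) => (L j).1 = i).map ev)
        ∪ ((Finset.univ.filter fun j : Fin (q + 1) => (L' j).1 = i).map od) := by
    ext p
    simp only [Finset.mem_filter, Finset.mem_univ, true_and, Finset.mem_union, Finset.mem_map, hev, hod]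
    constructor
    · intro hp
      by_cases hpar : p.val % 2 = 0
      · left
        refine ⟨⟨p.val / 2, by omega⟩, ?_, Fin.ext (by show 2 * (p.val / 2) = p.val; omega)⟩
        rw [← hp]; unfold pairFn; rw [if_pos hpar]
      · right
        refine ⟨⟨p.val / 2, by omega⟩, ?_, Fin.ext (by show 2 * (p.val / 2) + 1 = p.val; omega)⟩
        rw [← hp]; unfold pairFn; rw [if_neg hpar]
    · rintro (⟨j, hj, rfl⟩ | ⟨j, hj, rfl⟩)
      · rw [pairFn_even]; exact hj
      · rw [pairFn_odd]; exact hj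
  rw [hsplit, Finset.card_union_of_disjoint, Finset.card_map, Finset.card_map]
  rw [Finset.disjoint_left]
  rintro p hp1 hp2
  rw [Finset.mem_map] at hp1 hp2
  obtain ⟨j₁, _, rfl⟩ := hp1
  obtain ⟨j₂, _, h⟩ := hp2
  have h' : (2 * j₂.val + 1 : ℕ) = 2 * j₁.val := by rw [hev, hod] at h; exact congrArg Fin.val h
  omega

end Sum

end Summit.PneNP.PneNP.Theorems.SfmBlMachine
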